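import Summits.QuantumFields.BalabanUV.Beta.BorderGaugeLegContactTwo
import Summits.QuantumFields.BalabanUV.Beta.FP.PeriodisedSymBorderWardContactTwo

/-!
# `BalabanUV.Beta.FP.PeriodisedBorderWardContactTwo` — road «FP», ROUTE T, binder row D1, (COV-m) ORDER 2: **THE ROOTED SECOND-ORDER BORDER PAIR, PERIODISED IN ITS
# SECOND BOND AND ON THE TORUS, AGAINST THE TORUS GAUGE MODES = FOUR CONTACT TERMS** (torus face of `Beta/BorderGaugeLegContactTwo` §3; the ROOTED, generic-`d`,
# any-root twin of my g23 T1 `PeriodisedSymBorderWardContactTwo` — the brick of the composite tower's one-step second-order insertion law `stepIns₂_mul_tgrad`)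

WHAT ([folklore] finite sums BY NAME).  §1 (lattice, generic `d`, root `ρ = toSite r`, `r ∈ box`, `1 ≤ L`): entry ∕ support ∕ summability of the SYMMETRISED PACKED PAIR
`½(vh₂SAt ρ L κ u κ′ u′ + vh₂SAt ρ L κ′ u′ κ u)` on the `(inr, inl)` block and the `dψ`-form of its fluctuation-leg law in TABLE letters **`tsum_pair_mul_dz_tables`**
(the rooted border table `vhSAt ρ` of THIS bond read at the OTHER bond's slot and vice versa; diagonal and far root read the rooted packed first-order kernel `linSymAt ρ`).
§2 (torus `M = L·M′`, both bonds torus points): for the second-bond-periodised pair `V κ u := Σ'_n ½(vh₂SAt ρ κ u κ′ (u′+M∘n) + vh₂SAt ρ κ′ (u′+M∘n) κ u)` — period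
covariance `borderT2_periodCov`, windows, the law `borderT2_law` against the periodic indicators, the bridges `sum_sum_vhSAt_eq_perZ_dper` (double copy sum = C1's torus
member), `sum_linSymAt_eq_perZ` (g17's `tsum_linSymAt_translate_eq` on a window), `sum_sum_ite_eq'` (two torus bonds share a copy iff EQUAL) — and via T0's engine
`PeriodisedGaugeLegContacts.sum_perZ_dper_mul_tgrad_of_law` **`sum_perZ_dper_borderT2_mul_tgrad`** ∕ **`submatrix_borderT2_mul_tgrad`** (ALL columns, ANY multiplier
presentation, any level `j` on the right):
`Σ_{y,α} perZ M (dper M (V κ u)) x y (inr μ)(inl α)·tgrad M (y, inl α) s = tdelta M (u′+e_{κ′}) s·perZ M (dper M (vhSAt ρ κ u)) x u′ (inr μ)(inl κ′)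
+ tdelta M (u+e_κ) s·perZ M (dper M (vhSAt ρ κ′ u′)) x u (inr μ)(inl κ) − tdelta M (u+e_κ) s·[(κ,u)=(κ′,u′)]·c_j·perZ M (bhKStepAt d ρ L j) x u (inr μ)(inl κ)
+ tdelta M (x+ρ+L·e_μ) s·(c_j·perZ M (bhKStepAt …) x u (inr μ)(inl κ))·(c_j·perZ M (bhKStepAt …) x u′ (inr μ)(inl κ′))`, `c_j = (L^{d+1}·stepScale d L j)⁻¹`.
No `def`, no `def … : Prop`, nothing cited, 0 sorry.  Consumer: `FP/TorusCompositeCovarianceTwoStep.stepIns₂_mul_tgrad`.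

HONEST DEPENDENCY (page 1, mandatory): continuum YM on T⁴ ⇐ BetaPertH ∧ nine spine estimates (0/9 proved); BetaPertH ⇐ (D1) ∧ (D4) ∧ CAP+tail;
G-an2-4 gates asym, D1 and NE2/3/4.  HONEST FRAMING (cell contract, verbatim): «discharging `BetaPertH` makes Bałaban's UV stability UNCONDITIONAL —
a real constructive-QFT result; it is NOT the continuum limit and NOT the Clay problem.»  ABSOLUTE RULE (cell charter, verbatim): «No internally-minted
statement may enter as a cited fact. Every hypothesis is either kernel-proved in this package or a verbatim quotation of a PUBLISHED theorem with page
reference. The manuscript(s) under audit are NOT citable for their own disputed steps — they are the thing under adjudication; programme-internal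
(2001/route/tribunal) claims are never citable.»  0 estimates; 0∕4 row-D1 binders (hW, hR, D1Tel, D1Rep); NOT (T-ID), NOT (J-a) complete, NOT SDF, NOT D1,
NOT BetaPertH, NOT continuum, NOT Clay.  Nothing of the dictionary ∕ Bałaban's asserted (that an1's `vh₂SAt` IS the one-step averaging's second border jet is an2's
TABLE word).  D1 formalisation swarm LEAF PROVER 02 (b2b-balaban-beta-d1-formalise-leaf-02 gen 25), 2026-08-23.  No existing file touched.
-/

noncomputable section

open scoped BigOperators

namespace Summit.QuantumFields.BalabanUV.Beta.FP.PeriodisedBorderWardContactTwo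

open Finset
open Literature.MathematicalPhysics.QuantumFieldTheory.Balaban1983to89
open Literature.MathematicalPhysics.QuantumFieldTheory.Balaban1983to89.Beta
open ExpKernelCalculus (MKer shiftK)
open AffineAveraging (Site box toSite unitVec dz)
open AveragingContours (blk off)
open AveragingHessianKernels (packVH_inr_inl Near)
open AveragingHessianKernelsRooted (vhSAt vhSAt_translate vhKerAt linKerAt)
open AveragingMixedJetTables (vh2Tab vh2KerAt vh₂SAt vh₂SAt_translate vh2Tab_eq_zero₁ vh2Tab_eq_zero₂ vh2Tab_eq_zero₃)
open OneStepResolventKernel (Fib)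
open B4TorusKernel.MultiPeriod (translate translate_apply)
open B4Reflection242 (translate_translate)
open B6Lemma24Torus (pbox mem_pbox wrap wrap_eq_self wrap_congr)
open Summit.QuantumFields.BalabanUV.Beta.BorderedHessian (bhKStepAt stepScale)
open Summit.QuantumFields.BalabanUV.Beta.AveragingWardRootedStencils (linSymAt linSymAt_inr_inl)
open Summit.QuantumFields.BalabanUV.Beta.BorderGaugeLegContactTwo (gaugeLeg_vh₂SAt_symm_inr_inl)
open Summit.QuantumFields.BalabanUV.Beta.GAN24.BorderGaugeLegContact (tsum_sum_dz_mul_eq vhSAt_inr_inl_eq_zero_of_not_mem)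
open Summit.QuantumFields.BalabanUV.Beta.FP.KernelPeriodisationFib (Idx perF perF_apply perZ perZ_apply)
open Summit.QuantumFields.BalabanUV.Beta.FP.KernelPeriodisationFibLoc (dper)
open Summit.QuantumFields.BalabanUV.Beta.FP.TorusGaugeCovariance (tdelta tdelta_translate tdelta_congr tgrad nearBox mem_nearBox)
open Summit.QuantumFields.BalabanUV.Beta.FP.PeriodisedBorderTables (dper_apply_of_blockCov apply_translate_of_blockCov₂)
open Summit.QuantumFields.BalabanUV.Beta.FP.PeriodisedBorderIndexWard (translate_injective)
open Summit.QuantumFields.BalabanUV.Beta.FP.PeriodisedBorderWardContact (vhSAt_inr_inl_eq_zero_of_not_mem_family linSymAt_inr_inl_eq_zero_of_not_mem_family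
  tsum_linSymAt_translate_eq)
open Summit.QuantumFields.BalabanUV.Beta.FP.PeriodisedSymBorderWardContactTwo (tsum_mul_lin4 ite_diag_and_tip_eq_mul)
open Summit.QuantumFields.BalabanUV.Beta.FP.PeriodisedGaugeLegContacts (sum_perZ_dper_mul_tgrad_of_law)

variable {d : ℕ}

/-! ## §1 Entries, support and the `dψ`-form of the symmetrised rooted pair's fluctuation-leg law -/

section Lattice

variable {L : ℕ} {r : Fin (d + 1) → ℕ} (hr : r ∈ box (d + 1) L)
include hr

omit hr in
/-- [folklore] The `(inr μ, inl α)` entry of an1's packed rooted second-order table: the kernel `s((α,z); (κ,u), (κ′,u′))` on the root sites. -/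
theorem vh₂SAt_inr_inl_eq (ρ : Site (d + 1)) (L : ℕ) (κ : Fin (d + 1)) (u : Site (d + 1)) (κ' : Fin (d + 1)) (u' x z : Site (d + 1)) (μ α : Fin (d + 1)) :
    vh₂SAt ρ L κ u κ' u' x z (Sum.inr μ) (Sum.inl α) = if off L x = 0 then vh2KerAt ρ L μ (blk L x) (α, z) (κ, u) (κ', u') else 0 := by
  simp only [vh₂SAt, packVH_inr_inl]

/-- [folklore] the real rooted second-order kernel vanishes when ANY of its three bonds is based off the support box of the block (an1's `vh2Tab_eq_zero₁∕₂∕₃`). -/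
theorem vh2KerAt_eq_zero_of_not_near (μ : Fin (d + 1)) (y : Site (d + 1)) {f g g' : AveragingHessianKernels.Bond (d + 1)}
    (h : ¬ Near L y f.2 ∨ ¬ Near L y g.2 ∨ ¬ Near L y g'.2) : vh2KerAt (toSite r) L μ y f g g' = 0 := by
  unfold vh2KerAt
  rcases h with h | h | h
  · rw [vh2Tab_eq_zero₁ hr μ y h]; push_cast; rfl
  · rw [vh2Tab_eq_zero₂ hr μ y f h]; push_cast; rfl
  · rw [vh2Tab_eq_zero₃ hr μ y f g h]; push_cast; rfl

/-- [folklore] support of the `(inr, inl)` entries of the SYMMETRISED PAIR: off the window of the block of `x` in the fluctuation site `z`, or in either bond base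
`u`, `u′`, the entry vanishes. -/
theorem pair_inr_inl_eq_zero_of_not_mem (κ : Fin (d + 1)) (u : Site (d + 1)) (κ' : Fin (d + 1)) (u' x z : Site (d + 1)) (μ α : Fin (d + 1))
    (h : z ∉ nearBox L (blk L x) ∨ u ∉ nearBox L (blk L x) ∨ u' ∉ nearBox L (blk L x)) :
    (1 / 2 : ℝ) * (vh₂SAt (toSite r) L κ u κ' u' x z (Sum.inr μ) (Sum.inl α) + vh₂SAt (toSite r) L κ' u' κ u x z (Sum.inr μ) (Sum.inl α)) = 0 := by
  rw [mem_nearBox, mem_nearBox, mem_nearBox] at h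
  rw [vh₂SAt_inr_inl_eq, vh₂SAt_inr_inl_eq]
  by_cases hx : off L x = 0
  · rw [if_pos hx, if_pos hx]
    rcases h with h | h | h
    · rw [vh2KerAt_eq_zero_of_not_near hr μ _ (f := (α, z)) (Or.inl h), vh2KerAt_eq_zero_of_not_near hr μ _ (f := (α, z)) (Or.inl h)]; ring
    · rw [vh2KerAt_eq_zero_of_not_near hr μ _ (g := (κ, u)) (Or.inr (Or.inl h)), vh2KerAt_eq_zero_of_not_near hr μ _ (g' := (κ, u)) (Or.inr (Or.inr h))]; ring
    · rw [vh2KerAt_eq_zero_of_not_near hr μ _ (g' := (κ', u')) (Or.inr (Or.inr h)), vh2KerAt_eq_zero_of_not_near hr μ _ (g := (κ', u')) (Or.inr (Or.inl h))]; ring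
  · rw [if_neg hx, if_neg hx]; ring

omit hr in
/-- [folklore] dictionary: the `(inr μ, inl α)` entry of the rooted border table `vhSAt ρ` is the packed first-order kernel `m((α,z),(κ,u))` on the root sites. -/
theorem vhSAt_inr_inl_eq' (ρ : Site (d + 1)) (L : ℕ) (κ : Fin (d + 1)) (u x z : Site (d + 1)) (μ α : Fin (d + 1)) :
    vhSAt ρ d L rfl κ u x z (Sum.inr μ) (Sum.inl α) = if off L x = 0 then vhKerAt ρ L μ (blk L x) (α, z) (κ, u) else 0 := by
  simp only [vhSAt, packVH_inr_inl]

open Classical in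
/-- [folklore] **THE `dψ`-FORM OF THE SYMMETRISED ROOTED PAIR's FLUCTUATION-LEG LAW IN TABLE LETTERS** (root `toSite r`, `r ∈ box`, `1 ≤ L`; multiplier leg at `x`, for
EVERY `ψ`): `Σ'_z Σ_α ½(S₂ κ u κ′ u′ + S₂ κ′ u′ κ u) x z (inr μ) (inl α)·(dz ψ)_α(z) = ψ(u′ + e_{κ′})·vhSAt ρ κ u x u′ (inr μ) (inl κ′) + ψ(u + e_κ)·vhSAt ρ κ′ u′ x u (inr μ) (inl κ)
− ψ(u + e_κ)·[(κ,u) = (κ′,u′)]·linSymAt ρ L x u (inr μ) (inl κ) + ψ(x + ρ + L·e_μ)·linSymAt ρ L x u (inr μ) (inl κ)·linSymAt ρ L x u′ (inr μ) (inl κ′)`. -/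
theorem tsum_pair_mul_dz_tables (hL : 1 ≤ L) (κ : Fin (d + 1)) (u : Site (d + 1)) (κ' : Fin (d + 1)) (u' x : Site (d + 1)) (μ : Fin (d + 1)) (ψ : Site (d + 1) → ℝ) :
    ∑' z, ∑ α, (1 / 2 : ℝ) * (vh₂SAt (toSite r) L κ u κ' u' x z (Sum.inr μ) (Sum.inl α) + vh₂SAt (toSite r) L κ' u' κ u x z (Sum.inr μ) (Sum.inl α)) * dz ψ α z
      = ψ (u' + unitVec κ') * vhSAt (toSite r) d L rfl κ u x u' (Sum.inr μ) (Sum.inl κ')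
        + ψ (u + unitVec κ) * vhSAt (toSite r) d L rfl κ' u' x u (Sum.inr μ) (Sum.inl κ)
        - ψ (u + unitVec κ) * ((if (κ, u) = (κ', u') then (1 : ℝ) else 0) * linSymAt (toSite r) L x u (Sum.inr μ) (Sum.inl κ))
        + ψ (x + toSite r + (L : ℤ) • unitVec μ) * (linSymAt (toSite r) L x u (Sum.inr μ) (Sum.inl κ) * linSymAt (toSite r) L x u' (Sum.inr μ) (Sum.inl κ')) := by
  have h : ∀ z, ∑ α, (1 / 2 : ℝ) * (vh₂SAt (toSite r) L κ u κ' u' x z (Sum.inr μ) (Sum.inl α) + vh₂SAt (toSite r) L κ' u' κ u x z (Sum.inr μ) (Sum.inl α)) * dz ψ α z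
      = ∑ α, dz ψ α z * ((1 / 2 : ℝ) * (vh₂SAt (toSite r) L κ u κ' u' x z (Sum.inr μ) (Sum.inl α) + vh₂SAt (toSite r) L κ' u' κ u x z (Sum.inr μ) (Sum.inl α))) :=
    fun z => Finset.sum_congr rfl fun α _ => mul_comm _ _
  rw [vhSAt_inr_inl_eq', vhSAt_inr_inl_eq', linSymAt_inr_inl, linSymAt_inr_inl]
  rw [tsum_congr h, tsum_sum_dz_mul_eq (fun α z => (1 / 2 : ℝ) * (vh₂SAt (toSite r) L κ u κ' u' x z (Sum.inr μ) (Sum.inl α) + vh₂SAt (toSite r) L κ' u' κ u x z (Sum.inr μ) (Sum.inl α)))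
    (fun α g => summable_of_ne_finset_zero (s := nearBox L (blk L x)) fun z hz => by rw [pair_inr_inl_eq_zero_of_not_mem hr κ u κ' u' x z μ α (Or.inl hz), mul_zero]) ψ]
  simp only [gaugeLeg_vh₂SAt_symm_inr_inl hL]
  by_cases hx : off L x = 0
  · simp only [hx, if_true, ite_diag_and_tip_eq_mul κ κ' u u']
    have e : ∀ z : Site (d + 1), ψ z * ((if u' + unitVec κ' = z then (1 : ℝ) else 0) * vhKerAt (toSite r) L μ (blk L x) (κ', u') (κ, u)
          + (if u + unitVec κ = z then (1 : ℝ) else 0) * vhKerAt (toSite r) L μ (blk L x) (κ, u) (κ', u')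
          - (if (κ, u) = (κ', u') then (1 : ℝ) else 0) * (if u + unitVec κ = z then (1 : ℝ) else 0) * linKerAt (toSite r) L μ (blk L x) (κ, u)
          + (if x + toSite r + (L : ℤ) • unitVec μ = z then (1 : ℝ) else 0) * (linKerAt (toSite r) L μ (blk L x) (κ, u) * linKerAt (toSite r) L μ (blk L x) (κ', u')))
        = ψ z * ((if u' + unitVec κ' = z then (1 : ℝ) else 0) * vhKerAt (toSite r) L μ (blk L x) (κ', u') (κ, u)
          + (if u + unitVec κ = z then (1 : ℝ) else 0) * vhKerAt (toSite r) L μ (blk L x) (κ, u) (κ', u')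
          - (if u + unitVec κ = z then (1 : ℝ) else 0) * ((if (κ, u) = (κ', u') then (1 : ℝ) else 0) * linKerAt (toSite r) L μ (blk L x) (κ, u))
          + (if x + toSite r + (L : ℤ) • unitVec μ = z then (1 : ℝ) else 0)
              * (linKerAt (toSite r) L μ (blk L x) (κ, u) * linKerAt (toSite r) L μ (blk L x) (κ', u'))) := fun z => by ring
    rw [tsum_congr e, tsum_mul_lin4]
  · simp [hx]

end Lattice

/-! ## §2 The torus face (`M = L·M′`): the second-bond-periodised rooted pair, periodised, against the torus gauge-mode columns -/

section Torus

variable {M M' : Fin (d + 1) → ℕ} [∀ μ, NeZero (M μ)] {L : ℕ} [NeZero L] {r : Fin (d + 1) → ℕ} (hr : r ∈ box (d + 1) L) (κ' : Fin (d + 1)) (u' : Site (d + 1))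
  {V : Fin (d + 1) → Site (d + 1) → MKer (d + 1) (Fib d)}
include hr

omit [∀ μ, NeZero (M μ)] [NeZero L] hr in
/-- [folklore] the periodic indicator reads a shifted copy of a site as the shifted site: `tdelta M (u + M∘n + e) s = tdelta M (u + e) s`. -/
theorem tdelta_translate_add (u n e : Site (d + 1)) (s : ↥(pbox M)) : tdelta M (translate M u n + e) s = tdelta M (u + e) s :=
  tdelta_congr M (fun i => ⟨n i, by rw [Pi.add_apply, Pi.add_apply, translate_apply]; ring⟩) s

omit [∀ μ, NeZero (M μ)] [NeZero L] in
/-- [folklore] the four table entries of the law vanish when the OTHER bond is outside the window of the multiplier's block. -/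
theorem tables_eq_zero_of_snd_not_mem (κ : Fin (d + 1)) (u x : Site (d + 1)) (μ : Fin (d + 1)) {w : Site (d + 1)} (hw : w ∉ nearBox L (blk L x)) (t₁ t₂ t₃ : ℝ) :
    t₁ * vhSAt (toSite r) d L rfl κ u x w (Sum.inr μ) (Sum.inl κ') + t₂ * vhSAt (toSite r) d L rfl κ' w x u (Sum.inr μ) (Sum.inl κ)
        - t₂ * ((if (κ, u) = (κ', w) then (1 : ℝ) else 0) * linSymAt (toSite r) L x u (Sum.inr μ) (Sum.inl κ))
        + t₃ * (linSymAt (toSite r) L x u (Sum.inr μ) (Sum.inl κ) * linSymAt (toSite r) L x w (Sum.inr μ) (Sum.inl κ')) = 0 := by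
  rw [vhSAt_inr_inl_eq_zero_of_not_mem hr κ u x μ κ' hw, vhSAt_inr_inl_eq_zero_of_not_mem_family hr κ' x u μ κ hw, linSymAt_inr_inl_eq_zero_of_not_mem_family hr κ' x μ hw]
  by_cases h : (κ, u) = (κ', w)
  · obtain ⟨-, rfl⟩ := Prod.mk.inj h
    rw [linSymAt_inr_inl_eq_zero_of_not_mem_family hr κ x μ hw]; simp
  · simp [h]

omit [∀ μ, NeZero (M μ)] [NeZero L] in
/-- [folklore] the four table entries of the law vanish when THIS bond is outside the window of the multiplier's block. -/
theorem tables_eq_zero_of_fst_not_mem (κ : Fin (d + 1)) (x w : Site (d + 1)) (μ : Fin (d + 1)) {u : Site (d + 1)} (hu : u ∉ nearBox L (blk L x)) (t₁ t₂ t₃ : ℝ) :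
    t₁ * vhSAt (toSite r) d L rfl κ u x w (Sum.inr μ) (Sum.inl κ') + t₂ * vhSAt (toSite r) d L rfl κ' w x u (Sum.inr μ) (Sum.inl κ)
        - t₂ * ((if (κ, u) = (κ', w) then (1 : ℝ) else 0) * linSymAt (toSite r) L x u (Sum.inr μ) (Sum.inl κ))
        + t₃ * (linSymAt (toSite r) L x u (Sum.inr μ) (Sum.inl κ) * linSymAt (toSite r) L x w (Sum.inr μ) (Sum.inl κ')) = 0 := by
  rw [vhSAt_inr_inl_eq_zero_of_not_mem_family hr κ x w μ κ' hu, vhSAt_inr_inl_eq_zero_of_not_mem hr κ' w x μ κ hu, linSymAt_inr_inl_eq_zero_of_not_mem_family hr κ x μ hu]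
  simp

omit [NeZero L] in
/-- [folklore] the copies of the second bond meeting the block of the multiplier leg `x` are finitely many: on the `(inr, inl)` block the pair entry is summable in the copy
index (second-bond support `nearBox L (blk L x)`). -/
theorem summable_pair_translate_inr_inl (κ : Fin (d + 1)) (u x z : Site (d + 1)) (μ α : Fin (d + 1)) :
    Summable fun n : Site (d + 1) => (1 / 2 : ℝ) * (vh₂SAt (toSite r) L κ u κ' (translate M u' n) x z (Sum.inr μ) (Sum.inl α)
      + vh₂SAt (toSite r) L κ' (translate M u' n) κ u x z (Sum.inr μ) (Sum.inl α)) :=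
  summable_of_ne_finset_zero (s := (nearBox L (blk L x)).preimage (fun n => translate M u' n) (translate_injective (M := M) u').injOn)
    fun _ hn => pair_inr_inl_eq_zero_of_not_mem hr κ u κ' _ x z μ α (Or.inr (Or.inr fun h => hn (Finset.mem_preimage.2 h)))

omit [∀ μ, NeZero (M μ)] hr in
/-- [folklore] **JOINT INVARIANCE UNDER THE PERIOD LATTICE** of the second-bond-periodised rooted pair `V κ u := Σ'_n ½(S₂ κ u κ′ (u′+M∘n) + S₂ κ′ (u′+M∘n) κ u)`
(`M = L·M′`): `V κ (u + M∘m) (x + M∘m) (z + M∘m) = V κ u x z` — an1's block covariance `vh₂SAt_translate` per copy, re-indexing `n ↦ n + m`. -/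
theorem borderT2_periodCov (hM : ∀ i, M i = L * M' i)
    (hV : V = fun κ u x z a c => ∑' n : Site (d + 1), (1 / 2 : ℝ) * (vh₂SAt (toSite r) L κ u κ' (translate M u' n) x z a c + vh₂SAt (toSite r) L κ' (translate M u' n) κ u x z a c))
    (κ : Fin (d + 1)) (u m x z : Site (d + 1)) (a c : Fib d) :
    V κ (translate M u m) (translate M x m) (translate M z m) a c = V κ u x z a c := by
  have hL : 1 ≤ L := Nat.one_le_iff_ne_zero.mpr (NeZero.ne L)
  subst hV
  -- the two-bond pair as ONE block-covariant family `W κ u κ′ u′`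
  have hWt : ∀ (κ : Fin (d + 1)) (u : Site (d + 1)) (κ' : Fin (d + 1)) (u' t : Site (d + 1)),
      (fun x z a c => (1 / 2 : ℝ) * (vh₂SAt (toSite r) L κ (u + (L : ℤ) • t) κ' (u' + (L : ℤ) • t) x z a c + vh₂SAt (toSite r) L κ' (u' + (L : ℤ) • t) κ (u + (L : ℤ) • t) x z a c))
        = shiftK (-((L : ℤ) • t)) (fun x z a c => (1 / 2 : ℝ) * (vh₂SAt (toSite r) L κ u κ' u' x z a c + vh₂SAt (toSite r) L κ' u' κ u x z a c)) := by
    intro κ u κ' u' t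
    funext x z a c
    rw [vh₂SAt_translate hL, vh₂SAt_translate hL]
    rfl
  show (∑' n : Site (d + 1), (1 / 2 : ℝ) * (vh₂SAt (toSite r) L κ (translate M u m) κ' (translate M u' n) (translate M x m) (translate M z m) a c
        + vh₂SAt (toSite r) L κ' (translate M u' n) κ (translate M u m) (translate M x m) (translate M z m) a c))
      = ∑' n : Site (d + 1), (1 / 2 : ℝ) * (vh₂SAt (toSite r) L κ u κ' (translate M u' n) x z a c + vh₂SAt (toSite r) L κ' (translate M u' n) κ u x z a c)
  rw [← (Equiv.addRight m).tsum_eq (fun n => (1 / 2 : ℝ) * (vh₂SAt (toSite r) L κ (translate M u m) κ' (translate M u' n) (translate M x m) (translate M z m) a c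
        + vh₂SAt (toSite r) L κ' (translate M u' n) κ (translate M u m) (translate M x m) (translate M z m) a c))]
  refine tsum_congr fun n => ?_
  have key := apply_translate_of_blockCov₂ hM
    (W := fun κ u κ' u' => fun x z a c => (1 / 2 : ℝ) * (vh₂SAt (toSite r) L κ u κ' u' x z a c + vh₂SAt (toSite r) L κ' u' κ u x z a c))
    hWt κ (translate M u m) κ' (translate M u' (n + m)) m x z a c
  rw [Equiv.coe_addRight]
  rw [translate_translate, translate_translate, add_neg_cancel, add_neg_cancel_right] at key
  have e0 : translate M u (0 : Site (d + 1)) = u := by funext i; rw [translate_apply, Pi.zero_apply, mul_zero, add_zero]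
  rw [e0] at key
  exact key

omit [∀ μ, NeZero (M μ)] [NeZero L] in
/-- [folklore] window letter `hT` (first bond = family index): on the `(inr, inl)` block `V κ u x z` vanishes unless `u ∈ nearBox L (blk L x)`. -/
theorem borderT2_inr_inl_eq_zero_of_not_mem_T
    (hV : V = fun κ u x z a c => ∑' n : Site (d + 1), (1 / 2 : ℝ) * (vh₂SAt (toSite r) L κ u κ' (translate M u' n) x z a c + vh₂SAt (toSite r) L κ' (translate M u' n) κ u x z a c))
    (κ : Fin (d + 1)) (x z : Site (d + 1)) (μ α : Fin (d + 1)) : ∀ u ∉ nearBox L (blk L x), V κ u x z (Sum.inr μ) (Sum.inl α) = 0 := fun u hu => by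
  subst hV
  exact (tsum_congr fun n => pair_inr_inl_eq_zero_of_not_mem hr κ u κ' _ x z μ α (Or.inr (Or.inl hu))).trans tsum_zero

omit [∀ μ, NeZero (M μ)] [NeZero L] in
/-- [folklore] window letter `hS` (fluctuation leg): on the `(inr, inl)` block `V κ u x z` vanishes unless `z ∈ nearBox L (blk L x)`. -/
theorem borderT2_inr_inl_eq_zero_of_not_mem_S
    (hV : V = fun κ u x z a c => ∑' n : Site (d + 1), (1 / 2 : ℝ) * (vh₂SAt (toSite r) L κ u κ' (translate M u' n) x z a c + vh₂SAt (toSite r) L κ' (translate M u' n) κ u x z a c))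
    (κ : Fin (d + 1)) (u x : Site (d + 1)) (μ α : Fin (d + 1)) : ∀ z ∉ nearBox L (blk L x), V κ u x z (Sum.inr μ) (Sum.inl α) = 0 := fun z hz => by
  subst hV
  exact (tsum_congr fun n => pair_inr_inl_eq_zero_of_not_mem hr κ u κ' _ x z μ α (Or.inl hz)).trans tsum_zero

open Classical in
/-- [folklore] **THE FLUCTUATION-LEG LAW OF THE SECOND-BOND-PERIODISED ROOTED PAIR, `dψ`-FORM AGAINST THE PERIODIC INDICATORS** (`hlaw` of T0's engine): for `V κ u` as
above and `ψ = tdelta M · s`, the law is the copy sum of §1's table-letter law, the other bond's tip read through the period. -/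
theorem borderT2_law
    (hV : V = fun κ u x z a c => ∑' n : Site (d + 1), (1 / 2 : ℝ) * (vh₂SAt (toSite r) L κ u κ' (translate M u' n) x z a c + vh₂SAt (toSite r) L κ' (translate M u' n) κ u x z a c))
    (κ : Fin (d + 1)) (u x : Site (d + 1)) (μ : Fin (d + 1)) (s : ↥(pbox M)) : ∑' z, ∑ α, V κ u x z (Sum.inr μ) (Sum.inl α) * dz (fun w => tdelta M w s) α z
      = ∑' n : Site (d + 1), (tdelta M (u' + unitVec κ') s * vhSAt (toSite r) d L rfl κ u x (translate M u' n) (Sum.inr μ) (Sum.inl κ')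
          + tdelta M (u + unitVec κ) s * vhSAt (toSite r) d L rfl κ' (translate M u' n) x u (Sum.inr μ) (Sum.inl κ)
          - tdelta M (u + unitVec κ) s * ((if (κ, u) = (κ', translate M u' n) then (1 : ℝ) else 0) * linSymAt (toSite r) L x u (Sum.inr μ) (Sum.inl κ))
          + tdelta M (x + toSite r + (L : ℤ) • unitVec μ) s * (linSymAt (toSite r) L x u (Sum.inr μ) (Sum.inl κ) * linSymAt (toSite r) L x (translate M u' n) (Sum.inr μ) (Sum.inl κ'))) := by
  have hL : 1 ≤ L := Nat.one_le_iff_ne_zero.mpr (NeZero.ne L)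
  subst hV
  -- the copies of the other bond meeting the block of `x` are finitely many
  set Fn : Finset (Site (d + 1)) := (nearBox L (blk L x)).preimage (fun n => translate M u' n) (translate_injective (M := M) u').injOn with hFn
  have hFn' : ∀ n ∉ Fn, translate M u' n ∉ nearBox L (blk L x) := fun n hn h => hn (Finset.mem_preimage.2 h)
  have hVfin : ∀ (z : Site (d + 1)) (α : Fin (d + 1)), (∑' n : Site (d + 1), (1 / 2 : ℝ) * (vh₂SAt (toSite r) L κ u κ' (translate M u' n) x z (Sum.inr μ) (Sum.inl α)
        + vh₂SAt (toSite r) L κ' (translate M u' n) κ u x z (Sum.inr μ) (Sum.inl α)))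
      = ∑ n ∈ Fn, (1 / 2 : ℝ) * (vh₂SAt (toSite r) L κ u κ' (translate M u' n) x z (Sum.inr μ) (Sum.inl α) + vh₂SAt (toSite r) L κ' (translate M u' n) κ u x z (Sum.inr μ) (Sum.inl α)) :=
    fun z α => tsum_eq_sum fun n hn => pair_inr_inl_eq_zero_of_not_mem hr κ u κ' _ x z μ α (Or.inr (Or.inr (hFn' n hn)))
  have hsm : ∀ n ∈ Fn, Summable fun z : Site (d + 1) => ∑ α : Fin (d + 1), (1 / 2 : ℝ) * (vh₂SAt (toSite r) L κ u κ' (translate M u' n) x z (Sum.inr μ) (Sum.inl α)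
        + vh₂SAt (toSite r) L κ' (translate M u' n) κ u x z (Sum.inr μ) (Sum.inl α)) * dz (fun w => tdelta M w s) α z := fun n _ =>
    summable_of_ne_finset_zero (s := nearBox L (blk L x)) fun z hz =>
      Finset.sum_eq_zero fun α _ => by rw [pair_inr_inl_eq_zero_of_not_mem hr κ u κ' _ x z μ α (Or.inl hz), zero_mul]
  have hswap : (∑' z : Site (d + 1), ∑ α : Fin (d + 1), (∑' n : Site (d + 1), (1 / 2 : ℝ) * (vh₂SAt (toSite r) L κ u κ' (translate M u' n) x z (Sum.inr μ) (Sum.inl α)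
          + vh₂SAt (toSite r) L κ' (translate M u' n) κ u x z (Sum.inr μ) (Sum.inl α))) * dz (fun w => tdelta M w s) α z)
      = ∑ n ∈ Fn, ∑' z : Site (d + 1), ∑ α : Fin (d + 1), (1 / 2 : ℝ) * (vh₂SAt (toSite r) L κ u κ' (translate M u' n) x z (Sum.inr μ) (Sum.inl α)
          + vh₂SAt (toSite r) L κ' (translate M u' n) κ u x z (Sum.inr μ) (Sum.inl α)) * dz (fun w => tdelta M w s) α z := by
    rw [← Summable.tsum_finsetSum hsm]
    refine tsum_congr fun z => ?_
    rw [Finset.sum_comm]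
    exact Finset.sum_congr rfl fun α _ => by rw [hVfin z α, Finset.sum_mul]
  rw [hswap, Finset.sum_congr rfl fun n _ => tsum_pair_mul_dz_tables hr hL κ u κ' (translate M u' n) x μ (fun w => tdelta M w s)]
  simp only [tdelta_translate_add]
  exact (tsum_eq_sum fun n hn => tables_eq_zero_of_snd_not_mem hr κ' κ u x μ (hFn' n hn) _ _ _).symm

omit [∀ μ, NeZero (M μ)] in
/-- [folklore] the periodised rooted border member vanishes on the `(inr, inl)` block off the window of the block of `x` (support under the copy sum; `M = L·M′`). -/
theorem dper_vhSAt_inr_inl_eq_zero_of_not_mem (hM : ∀ i, M i = L * M' i) (x : Site (d + 1)) (μ α : Fin (d + 1)) :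
    ∀ z ∉ nearBox L (blk L x), dper M (vhSAt (toSite r) d L rfl κ' u') x z (Sum.inr μ) (Sum.inl α) = 0 := fun z hz => by
  have hL : 1 ≤ L := Nat.one_le_iff_ne_zero.mpr (NeZero.ne L)
  rw [dper_apply_of_blockCov hM (fun κ u t => vhSAt_translate (toSite r) hL κ u t) κ' u' x z (Sum.inr μ) (Sum.inl α)]
  exact (tsum_congr fun n => vhSAt_inr_inl_eq_zero_of_not_mem hr κ' _ x μ α hz).trans tsum_zero

omit [∀ μ, NeZero (M μ)] in
/-- [folklore] bridge: the double copy sum of the rooted border table of THIS bond read at the other bond's slot IS C1's torus member `perZ M (dper M (vhSAt ρ κ u))` at the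
other torus bond (finite windows `Fm ⊇` copies of `u`, `Fn ⊇` copies of `u′` meeting the block of `x`). -/
theorem sum_sum_vhSAt_eq_perZ_dper (hM : ∀ i, M i = L * M' i) (κ : Fin (d + 1)) (u x : Site (d + 1)) (μ : Fin (d + 1))
    {Fm Fn : Finset (Site (d + 1))} (hFm : ∀ m ∉ Fm, translate M u m ∉ nearBox L (blk L x)) (hFn : ∀ n ∉ Fn, translate M u' n ∉ nearBox L (blk L x)) :
    ∑ m ∈ Fm, ∑ n ∈ Fn, vhSAt (toSite r) d L rfl κ (translate M u m) x (translate M u' n) (Sum.inr μ) (Sum.inl κ')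
      = perZ M (dper M (vhSAt (toSite r) d L rfl κ u)) x u' (Sum.inr μ) (Sum.inl κ') := by
  have hL : 1 ≤ L := Nat.one_le_iff_ne_zero.mpr (NeZero.ne L)
  rw [Finset.sum_comm, perZ_apply]
  symm
  rw [tsum_eq_sum (s := Fn) fun n hn => dper_vhSAt_inr_inl_eq_zero_of_not_mem hr κ u hM x μ κ' _ (hFn n hn)]
  refine Finset.sum_congr rfl fun n _ => ?_
  rw [dper_apply_of_blockCov hM (fun κ u t => vhSAt_translate (toSite r) hL κ u t)]
  exact tsum_eq_sum fun m hm => vhSAt_inr_inl_eq_zero_of_not_mem_family hr κ x _ μ κ' (hFm m hm)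

omit [∀ μ, NeZero (M μ)] in
/-- [folklore] bridge: the copy sum of the rooted packed first-order kernel IS `c_j ·` the torus averaging row (g17's `tsum_linSymAt_translate_eq` on a window). -/
theorem sum_linSymAt_eq_perZ (j : ℕ) (u x : Site (d + 1)) (μ κ : Fin (d + 1)) {Fm : Finset (Site (d + 1))} (hFm : ∀ m ∉ Fm, translate M u m ∉ nearBox L (blk L x)) :
    ∑ m ∈ Fm, linSymAt (toSite r) L x (translate M u m) (Sum.inr μ) (Sum.inl κ)
      = ((L : ℝ) ^ (d + 1) * stepScale d L j)⁻¹ * perZ M (bhKStepAt d (toSite r) L j) x u (Sum.inr μ) (Sum.inl κ) := by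
  rw [← tsum_linSymAt_translate_eq (M := M) (toSite r) j x u μ κ]
  exact (tsum_eq_sum fun m hm => linSymAt_inr_inl_eq_zero_of_not_mem_family hr κ x μ (hFm m hm)).symm

open Classical in
omit [NeZero L] hr in
/-- [folklore] bridge: the diagonal contact — two torus bonds have a common copy iff they are EQUAL, and then copy by copy:
`Σ_{m} Σ_{n} [(κ, u + M∘m) = (κ′, u′ + M∘n)]·f m = [(κ,u) = (κ′,u′)]·Σ_m f m` (`u, u′` torus points; `Fn ⊇ Fm` when `u = u′`). -/
theorem sum_sum_ite_eq' (κ : Fin (d + 1)) {u : Site (d + 1)} (hu : u ∈ pbox M) (hu' : u' ∈ pbox M) (f : Site (d + 1) → ℝ) {Fm Fn : Finset (Site (d + 1))} (hF : u = u' → Fm ⊆ Fn) :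
    ∑ m ∈ Fm, ∑ n ∈ Fn, (if (κ, translate M u m) = (κ', translate M u' n) then (1 : ℝ) else 0) * f m = (if (κ, u) = (κ', u') then (1 : ℝ) else 0) * ∑ m ∈ Fm, f m := by
  by_cases h : (κ, u) = (κ', u')
  · obtain ⟨rfl, rfl⟩ := Prod.mk.inj h
    rw [if_pos rfl, one_mul]
    refine Finset.sum_congr rfl fun m hm => ?_
    rw [Finset.sum_eq_single_of_mem m (hF rfl hm) fun n _ hnm => by
      rw [if_neg fun e => hnm ((translate_injective (M := M) u) (Prod.mk.inj e).2).symm, zero_mul]]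
    rw [if_pos rfl, one_mul]
  · rw [if_neg h, zero_mul]
    -- a torus point is the wrapped representative of each of its copies (leaf-05's `PeriodisedFormGaugeLegTwo.wrap_translate_of_mem`, inlined)
    have hw : ∀ {w : Site (d + 1)}, w ∈ pbox M → ∀ m : Site (d + 1), wrap M (translate M w m) = w := fun hw m =>
      (wrap_congr (M := M) fun i => ⟨m i, by rw [translate_apply]; ring⟩).trans (wrap_eq_self hw)
    refine Finset.sum_eq_zero fun m _ => Finset.sum_eq_zero fun n _ => ?_
    rw [if_neg fun e => h ?_, zero_mul]
    obtain ⟨hκ, e⟩ := Prod.mk.inj e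
    have := congrArg (wrap M) e
    rw [hw hu, hw hu'] at this
    rw [hκ, this]

open Classical in
/-- [folklore] **`sum_perZ_dper_borderT2_mul_tgrad` — THE SECOND-BOND-PERIODISED ROOTED PAIR, PERIODISED, AGAINST A TORUS GAUGE-MODE COLUMN** (`M = L·M′`; both bonds torus
points; root `toSite r`, `r ∈ box`; any level `j` on the right): for `V κ u := Σ'_n ½(S₂ κ u κ′ (u′+M∘n) + S₂ κ′ (u′+M∘n) κ u)`, the multiplier row `(x, μ)` and any column `s`,
`Σ_y Σ_α perZ M (dper M (V κ u)) x y (inr μ) (inl α) · tgrad M (y, inl α) s =`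
` tdelta M (u′ + e_{κ′}) s · perZ M (dper M (vhSAt ρ κ u)) x u′ (inr μ) (inl κ′)` (the other bond's tip reads THIS bond's first-order member)
` + tdelta M (u + e_κ) s · perZ M (dper M (vhSAt ρ κ′ u′)) x u (inr μ) (inl κ)` (this bond's tip reads the OTHER bond's member)
` − tdelta M (u + e_κ) s · [(κ,u) = (κ′,u′)] · c_j · perZ M (bhKStepAt d ρ L j) x u (inr μ) (inl κ)` (diagonal)
` + tdelta M (x + ρ + L•e_μ) s · (c_j · perZ M (bhKStepAt …) x u (inr μ) (inl κ)) · (c_j · perZ M (bhKStepAt …) x u′ (inr μ) (inl κ′))` (far root; `c_j = (L^{d+1}·stepScale d L j)⁻¹`). -/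
theorem sum_perZ_dper_borderT2_mul_tgrad (hM : ∀ i, M i = L * M' i)
    (hV : V = fun κ u x z a c => ∑' n : Site (d + 1), (1 / 2 : ℝ) * (vh₂SAt (toSite r) L κ u κ' (translate M u' n) x z a c + vh₂SAt (toSite r) L κ' (translate M u' n) κ u x z a c))
    (hu' : u' ∈ pbox M) (j : ℕ) (κ : Fin (d + 1)) {u : Site (d + 1)} (hu : u ∈ pbox M) (x : Site (d + 1)) (μ : Fin (d + 1)) (s : ↥(pbox M)) :
    ∑ y : ↥(pbox M), ∑ α : Fin (d + 1), perZ M (dper M (V κ u)) x (y : Site (d + 1)) (Sum.inr μ) (Sum.inl α) * tgrad M (y, Sum.inl α) s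
      = tdelta M (u' + unitVec κ') s * perZ M (dper M (vhSAt (toSite r) d L rfl κ u)) x u' (Sum.inr μ) (Sum.inl κ')
        + tdelta M (u + unitVec κ) s * perZ M (dper M (vhSAt (toSite r) d L rfl κ' u')) x u (Sum.inr μ) (Sum.inl κ)
        - tdelta M (u + unitVec κ) s * ((if (κ, u) = (κ', u') then (1 : ℝ) else 0) * (((L : ℝ) ^ (d + 1) * stepScale d L j)⁻¹ * perZ M (bhKStepAt d (toSite r) L j) x u (Sum.inr μ) (Sum.inl κ)))
        + tdelta M (x + toSite r + (L : ℤ) • unitVec μ) s * ((((L : ℝ) ^ (d + 1) * stepScale d L j)⁻¹ * perZ M (bhKStepAt d (toSite r) L j) x u (Sum.inr μ) (Sum.inl κ))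
            * (((L : ℝ) ^ (d + 1) * stepScale d L j)⁻¹ * perZ M (bhKStepAt d (toSite r) L j) x u' (Sum.inr μ) (Sum.inl κ'))) := by
  rw [sum_perZ_dper_mul_tgrad_of_law V _ (fun x => nearBox L (blk L x)) (fun x => nearBox L (blk L x)) (borderT2_periodCov κ' u' hM hV)
    (fun κ u x μ α => borderT2_inr_inl_eq_zero_of_not_mem_S hr κ' u' hV κ u x μ α)
    (fun κ x z μ α => borderT2_inr_inl_eq_zero_of_not_mem_T hr κ' u' hV κ x z μ α) (borderT2_law hr κ' u' hV) κ u x μ s]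
  -- both copy sums are finite: windows of the block of `x`
  set Fn : Finset (Site (d + 1)) := (nearBox L (blk L x)).preimage (fun n => translate M u' n) (translate_injective (M := M) u').injOn with hFn
  have hFn' : ∀ n ∉ Fn, translate M u' n ∉ nearBox L (blk L x) := fun n hn h => hn (Finset.mem_preimage.2 h)
  set Fm : Finset (Site (d + 1)) := (nearBox L (blk L x)).preimage (fun m => translate M u m) (translate_injective (M := M) u).injOn with hFm
  have hFm' : ∀ m ∉ Fm, translate M u m ∉ nearBox L (blk L x) := fun m hm h => hm (Finset.mem_preimage.2 h)
  have hsub : u = u' → Fm ⊆ Fn := by rintro rfl; exact subset_of_eq (by rw [hFm, hFn])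
  simp only [tdelta_translate_add]
  rw [tsum_eq_sum (s := Fm) fun m hm => (tsum_congr fun n => tables_eq_zero_of_fst_not_mem hr κ' κ x (translate M u' n) μ (hFm' m hm) _ _ _).trans tsum_zero]
  rw [Finset.sum_congr rfl fun m _ => tsum_eq_sum (s := Fn) fun n hn => tables_eq_zero_of_snd_not_mem hr κ' κ (translate M u m) x μ (hFn' n hn) _ _ _]
  -- finite algebra: split the four terms and name each double window sum
  simp only [Finset.sum_add_distrib, Finset.sum_sub_distrib, ← Finset.mul_sum]
  rw [sum_sum_vhSAt_eq_perZ_dper hr κ' u' hM κ u x μ hFm' hFn']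
  have hB : ∑ m ∈ Fm, ∑ n ∈ Fn, vhSAt (toSite r) d L rfl κ' (translate M u' n) x (translate M u m) (Sum.inr μ) (Sum.inl κ)
      = perZ M (dper M (vhSAt (toSite r) d L rfl κ' u')) x u (Sum.inr μ) (Sum.inl κ) := by
    rw [Finset.sum_comm]; exact sum_sum_vhSAt_eq_perZ_dper hr κ u hM κ' u' x μ hFn' hFm'
  have hC : ∑ m ∈ Fm, ∑ n ∈ Fn, (if (κ, translate M u m) = (κ', translate M u' n) then (1 : ℝ) else 0) * linSymAt (toSite r) L x (translate M u m) (Sum.inr μ) (Sum.inl κ)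
      = (if (κ, u) = (κ', u') then (1 : ℝ) else 0) * (((L : ℝ) ^ (d + 1) * stepScale d L j)⁻¹ * perZ M (bhKStepAt d (toSite r) L j) x u (Sum.inr μ) (Sum.inl κ)) := by
    rw [sum_sum_ite_eq' κ' u' κ hu hu' _ hsub, sum_linSymAt_eq_perZ hr j u x μ κ hFm']
  have hD : ∑ m ∈ Fm, linSymAt (toSite r) L x (translate M u m) (Sum.inr μ) (Sum.inl κ) * ∑ n ∈ Fn, linSymAt (toSite r) L x (translate M u' n) (Sum.inr μ) (Sum.inl κ')
      = (((L : ℝ) ^ (d + 1) * stepScale d L j)⁻¹ * perZ M (bhKStepAt d (toSite r) L j) x u (Sum.inr μ) (Sum.inl κ))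
          * (((L : ℝ) ^ (d + 1) * stepScale d L j)⁻¹ * perZ M (bhKStepAt d (toSite r) L j) x u' (Sum.inr μ) (Sum.inl κ')) := by
    rw [← Finset.sum_mul, sum_linSymAt_eq_perZ hr j u x μ κ hFm', sum_linSymAt_eq_perZ hr j u' x μ κ' hFn']
  rw [hB, hC, hD]

/-- [folklore] **MATRIX FORM AT THE TORUS CALL's SLOT MAPS** (field slots `(b.1, inl b.2)`; multiplier slots `a ↦ (pμ a, inr (mμ a))`, `pμ a ∈ pbox M`; ANY column map `g`):
the per-pair entry of `T^{b,b′} · D`, `T^{b,b′} := (perF M (dper M (V b.2 ↑b.1))).submatrix …` for the pair family `V` of the second torus bond `b′ = (u′, κ′)`, in the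
letters of C1's rooted members `M^{b} := perF M (dper M (vhSAt ρ b))` and the averaging rows `Q := perF M (bhKStepAt d ρ L j)`:
`(T^{b,b′}·D)(a,c) = [g c ≡ b′₊]·M^{b}(a,b′) + [g c ≡ b₊]·M^{b′}(a,b) − [b = b′][g c ≡ b₊]·c_j·Q(a,b) + [g c ≡ pμ a + ρ + L•e_{mμ a}]·(c_j Q(a,b))·(c_j Q(a,b′))`. -/
theorem submatrix_borderT2_mul_tgrad (hM : ∀ i, M i = L * M' i)
    (hV : V = fun κ u x z a c => ∑' n : Site (d + 1), (1 / 2 : ℝ) * (vh₂SAt (toSite r) L κ u κ' (translate M u' n) x z a c + vh₂SAt (toSite r) L κ' (translate M u' n) κ u x z a c))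
    (hu' : u' ∈ pbox M) (j : ℕ) {μI γ : Type*} (pμ : μI → Site (d + 1)) (hpμ : ∀ a, pμ a ∈ pbox M) (mμ : μI → Fin (d + 1)) (g : γ → ↥(pbox M))
    (κ : Fin (d + 1)) (u : ↥(pbox M)) (a : μI) (c : γ) :
    ((perF M (dper M (V κ (u : Site (d + 1))))).submatrix (fun a : μI => ((⟨pμ a, hpμ a⟩, Sum.inr (mμ a)) : Idx M (Fib d))) (fun b : ↥(pbox M) × Fin (d + 1) => ((b.1, Sum.inl b.2) : Idx M (Fib d)))
        * (tgrad M).submatrix (fun b : ↥(pbox M) × Fin (d + 1) => ((b.1, Sum.inl b.2) : Idx M (Fib d))) g) a c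
      = tdelta M (u' + unitVec κ') (g c) * perF M (dper M (vhSAt (toSite r) d L rfl κ (u : Site (d + 1)))) (⟨pμ a, hpμ a⟩, Sum.inr (mμ a)) (⟨u', hu'⟩, Sum.inl κ')
        + tdelta M ((u : Site (d + 1)) + unitVec κ) (g c) * perF M (dper M (vhSAt (toSite r) d L rfl κ' u')) (⟨pμ a, hpμ a⟩, Sum.inr (mμ a)) (u, Sum.inl κ)
        - tdelta M ((u : Site (d + 1)) + unitVec κ) (g c) * ((if (κ, (u : Site (d + 1))) = (κ', u') then (1 : ℝ) else 0)
            * (((L : ℝ) ^ (d + 1) * stepScale d L j)⁻¹ * perF M (bhKStepAt d (toSite r) L j) (⟨pμ a, hpμ a⟩, Sum.inr (mμ a)) (u, Sum.inl κ)))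
        + tdelta M (pμ a + toSite r + (L : ℤ) • unitVec (mμ a)) (g c)
            * ((((L : ℝ) ^ (d + 1) * stepScale d L j)⁻¹ * perF M (bhKStepAt d (toSite r) L j) (⟨pμ a, hpμ a⟩, Sum.inr (mμ a)) (u, Sum.inl κ))
              * (((L : ℝ) ^ (d + 1) * stepScale d L j)⁻¹ * perF M (bhKStepAt d (toSite r) L j) (⟨pμ a, hpμ a⟩, Sum.inr (mμ a)) (⟨u', hu'⟩, Sum.inl κ'))) := by
  rw [Matrix.mul_apply, Fintype.sum_prod_type]
  simp only [Matrix.submatrix_apply, perF_apply]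
  exact sum_perZ_dper_borderT2_mul_tgrad hr κ' u' hM hV hu' j κ u.2 (pμ a) (mμ a) (g c)

end Torus

end Summit.QuantumFields.BalabanUV.Beta.FP.PeriodisedBorderWardContactTwo

end
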